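import Literature.MathematicalPhysics.QuantumFieldTheory.Balaban1983to89.B8Thm4ZdGF3HP2PerMapGammaPrime
import Literature.MathematicalPhysics.QuantumFieldTheory.Balaban1983to89.B8Eq142KLevelLocalGammaPrime
import Literature.MathematicalPhysics.QuantumFieldTheory.Balaban1983to89.B8TowerBondsPrinted
import Literature.MathematicalPhysics.QuantumFieldTheory.Balaban1983to89.B8Ineq166Univ
import Literature.MathematicalPhysics.QuantumFieldTheory.Balaban1983to89.B8Ineq165AllLevels
import Literature.MathematicalPhysics.QuantumFieldTheory.Balaban1983to89.B8LeafModelZd3P2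

/-!
# `Balaban1983to89.B8Thm2ZdGF3HP2PerMapGammaPrime` — [Balaban1985RegularSpaces] THEOREM 2 (p. 83) AS `B8.Thm2Printed` ON AN INDEX- AND PERIOD-MAPPED
# SUB-FAMILY OF THE PERIODIC MEMBER `zdGF3HP₂Per ∘ (ι, p)` OVER THE PERIODICITY-GUARDED γ′ SOCKET FAMILY — brick T6b of the package «N05-(β′)-GT»
# (director-ym №227 (b) «GUARDED REQUIRED»; plan g87 (R6)): dag-n05-w2's `B8Thm2ZdGF3P2MapGammaPrime` RE-RUN TOKEN FOR TOKEN with the Theorem-4 step :=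
# this seat's T6a `B8Thm4ZdGF3HP2PerMapGammaPrime.thm4Body_zdGF3HP₂Per_mapJ_γ'` and PROPOSITION 3 on the periodic image family as the hypothesis `hP3`

statement-level skeleton of published theorems with citation tags; proofs where landed; nothing here is a claim about the Yang–Mills mass gap

T. Bałaban, *Spaces of regular gauge field configurations on a lattice and gauge fixing conditions*, Commun. Math. Phys. **99** (1985) 75–102
`[Balaban1985RegularSpaces]` ("B8"; journal page = PDF page + 74): Thm 2 (1.36)–(1.39) p. 83 («B₁, B₂(β₀), c₁ … exactly one»), Thm 4 p. 88, Prop. 3 p. 87,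
(1.61) p. 87, (1.65)–(1.67) pp. 87–88, (1.33)–(1.35) ∕ (1.37) p. 82, p. 77 («Ω_j ⊂ T_η»), Thm 8 (1.146) p. 101; [4] (3.40) p. 397.

## WHY THIS FILE (cell `pub-ymgap`, HUMAN RULING D-0062; seat `pub-ymgap-dag-n05-c` (g17), package row (R6) T6b; count-neutral)

On the discharge road of record (№227 (b)) Theorem 2 at the κ-periodic members must come from sockets asked at PERIODIC data only.  Today's supplier
(`thm2Printed_hp2per_of_zd`, this seat's transfer′) reads the ℤᵈ theorem — BANKED.  THIS FILE is dag-n05-w2's ℤᵈ assembly itself at the periodic member: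
the Theorem-4 step is T6a (on T5, guarded sockets, periodic witness BY CONSTRUCTION), (1.65) ⇒ (1.66)₀ on `Ω₀ = ℤᵈ` (the periodic members keep `Ω 0 = univ`),
(1.37) at print's `α₁` by `H42_of_inAx_γ'`, (1.36) ∕ (1.39) from PROPOSITION 3 AS PRINTED on the PERIODIC image family (`hP3` over
`(zdGF3HP₂Per … (ι a) (p a)).toGFData2` — supplied in tree from the GUARDED Prop-3 socket by this seat's `B8LeafModelZdHP2Per.prop3Printed_hp2per_of_zd` ∕
dag-n05-w1's `B8Prop3PrintedZdGF3P2GammaOfSockPer` line), uniqueness = Theorem 4's.  Token map from the source: socket block ↦ T5's guarded texts,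
`(ι) ↦ (ι) (p)` + `hΩp`, `zdGF3(H)P₂ … (ι ·) ↦ zdGF3HP₂Per … (ι ·) (p ·)`, `subst` ↦ `Subtype.ext` pin, `P.1.2 ∕ P.2.2 ↦ .2.1`, `u.2.1 ↦ u.2.1.1`.

★★ `thm2Printed_zdGF3HP₂Per_mapJ_γ'` ⊢ `B8.Thm2Printed (fun a : J => (zdGF3HP₂Per 𝔸 L β len (ι a) (p a)).toGFData)`.

## HONEST SCOPE

An assembly BY NAME; NO estimate proved anew; the four guarded sockets and `hP3` are HYPOTHESES (servable in shape by torus statements — the open SUPPLIER side);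
no joint-satisfiability claim.  `d, L ≥ 2`; `T_η` as `(p a)`-periodic data on `ηℤᵈ`; `≤` for print's `<`.  Count-neutral; N05 NOT discharged; no count claim;
one finite `T⁴` programme at fixed `ε`, Bałaban AS PRINTED; the Yang–Mills mass gap (Clay) is NOT proved by any of this — R4 closes the conditional finite-𝕋⁴
rung `BalabanLadder.UV` only; nothing continuum ∕ ℝ⁴ ∕ OS.  No `sorry`, no `axiom`, no definition, no `instance`.  Unit `pub-ymgap-dag-n05-c` (g17), 2026-08-28.

[cite: Balaban1985RegularSpaces, Thm 2 (1.36)–(1.39) p.83, Thm 4 p.88, Prop. 3 p.87, (1.65)–(1.67) pp.87–88, (1.35)∕(1.37) p.82, p.77, Thm 8 (1.146) p.101]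
-/

noncomputable section

open NormedSpace

namespace Literature.MathematicalPhysics.QuantumFieldTheory.Balaban1983to89.B8Thm2ZdGF3HP2PerMapGammaPrime

open Complex (I)
open MatrixLog B7Prop1Explicit B7Prop2Explicit B7Prop1Local B7Eq92Concrete
open B7Prop2Explicit (C0 c2')
open B7Prop3Flat (c3)
open B8Ineq132 (covDerivFwd InAk BondTouches)
open B8Eq119TwistedAxial (Restr129 InAx)
open B8Eq184Proof (gaugeExp cfgExp)
open B8Lemma1NonAbelian (mulCfg)
open B8Eq140Level (SideTouches)
open B8Eq146AExpansion (iEta)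
open B7Prop4GeneralLevels (linCovIter)
open B8Eq155JBound (Jcur wsup)
open B8ScaledSupNorm (bondNorm msup)
open B8Thm2LogB (blockTop)
open B8Ineq130 (tlo thi)
open B8Eq138LandauZd (IsLandau138W logCfg)
open B8Prop3GaugeFixedKLevel (mem_unitaryUnits_of_mgauge_eq mulCfg_eq_gaugeAct_of_mgauge_eq)
open B8Thm4AtLandau138 (mgauge_mgauge_inv)
open B8Thm4Windows (thm4_windows thm4_windows_extra)
open B8Thm4ExistsConcreteGamma (thm4_windows_γ)
open B8LeafModelZd (ZdIdx)
open B8LeafModelZd3 (mlogCfg mlogCfg_spec)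
open B8LeafModelZd3P (zdGF3P zdGF3HP)
open B8LeafModelZd3P2 (zdGF3P₂ zdGF3HP₂)
open B8TowerBondsPrinted (towerBondsP)
open B9SupplySockB9P3ZdBeta (CrossB)
open B8Ineq166Univ (norm_pert_sub_one_le_univ)
open B8Thm4ZdGF3HP2PerMapGammaPrime (thm4Body_zdGF3HP₂Per_mapJ_γ')
open B8LeafModelZdHP2Per (zdGF3HP₂Per)
open T4TermwiseTorus (IsPeriodic)
open B7Prop4GeneralLevels (logCovIter)

-- `Site` alone could resolve to the torus sites of `Setup.lean`; re-export the `ℤ^d` sites of `B7Prop1Explicit`.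
export B7Prop1Explicit (Site)

variable {d : ℕ}

section Thm2

variable {𝔸 : Type} [CStarAlgebra 𝔸] [Nontrivial 𝔸]

/-- ★★ **`B8.Thm2Printed` ON AN INDEX- AND PERIOD-MAPPED SUB-FAMILY `zdGF3HP₂Per ∘ (ι, p)` OF THE PERIODIC MEMBER, GUARDED γ′ SOCKETS** (Theorem 2, p. 83
«There exist constants B₁, B₂(β₀), c₁ … exactly one gauge transformation u satisfying (1.29) and (1.36)–(1.39)»): dag-n05-w2's `thm2Printed_zdGF3HP₂_mapJ_γ'`
MEMBER BY MEMBER at the periodic member, LINE BY LINE with the Theorem-4 step := T6a `thm4Body_zdGF3HP₂Per_mapJ_γ'` (T5's periodic core at a zero source;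
constant `5dL·B₈`): for `d, L ≥ 2`, the leaf's `inp : B8.B9Inputs`, `B₀β > 0`, Prop. 5's radius `cu > 0`, the providers' threshold `cP > 0`, source constants
`γ′ ≥ 0`, `B₈ ≥ inp.B₀` with `5dL·inp.B₀ + 2γ′·inp.B₀ ≤ 5dL·B₈`, `2 ≤ 5dL·B₈`, any Hölder data `β, len` — MODULO the GUARDED γ′ socket family (T4b texts
member-ised: pair guard `IsPeriodic (p a) U₀ → IsPeriodic (p a) U′`, periodic riders), a zero source `(φ₀, hAdm₀, hLan₀)`, the members' tower laws and domain
periodicity (`htw`, `hΩp`), `Ω 0 = univ` (`hΩ`), and PROPOSITION 3 AS PRINTED on the periodic image family (`hP3`, any `C₂ ≤ 2097152(d+1)²L²`).  Proof: Theorem 4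
at the shifted pair `(α₀, α″ = 11d²(α₀ + α₁) + α₁)`; (1.66)₀ from (1.33)–(1.35) by (1.65) (`B8Ineq166Univ.norm_pert_sub_one_le_univ`); (1.37) AT PRINT's `α₁` by
`B8Eq142KLevelLocalGammaPrime.H42_of_inAx_γ'`; (1.36)∕(1.39) by `hP3` at `(α₀, α″, α₂ := 5dL·B₈·(α₀ + α″))`, its (1.61) from the γ window at `B₈`; uniqueness =
Theorem 4's among the member's PERIODIC competitors.  Constants `B₁ = 5dL·inp.B₀·(1 + 11d²)`, `B₂ = 5dL·B₀β·(1 + 11d²)`, ONE threshold.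
[cite: Balaban1985RegularSpaces, Thm 2 (1.36)–(1.39) p.83, Thm 4 p.88, Prop. 3 p.87, (1.65)–(1.67) pp.87–88, (1.35)∕(1.37) p.82, p.77 («Ω_j ⊂ T_η»), Thm 8 (1.146) p.101] -/
theorem thm2Printed_zdGF3HP₂Per_mapJ_γ' (hd2 : 2 ≤ d) {L : ℕ} (hL : 2 ≤ L) {β : ℝ} {len : Site d → ℝ} (inp : B8.B9Inputs)
    {B₀β cu cP C₂ : ℝ} (hB₀β : 0 < B₀β) (hcu : 0 < cu) (hcP : 0 < cP) (hC₂ : C₂ ≤ 2097152 * ((d : ℝ) + 1) ^ 2 * (L : ℝ) ^ 2)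
    -- THE γ′ SOCKET FAMILY OF RECORD ALONG AN INDEX MAP `ι : J → ZdIdx d L` (dag-n05-d's `B8Thm4CoreZdGF3HPLanEGamma.thm4Core_zdGF3HP_map_lanE_γ'`,
    -- verbatim at `B₀ := inp.B₀`, `B₀′ := inp.B₀′`): source data `Φ, γ′, B₈, Adm a, LanF a` and the four sourced sockets AT `ι a` (one-end-point (1.35) antecedent)
    {Φ : Type*} {γ' B₈ : ℝ} (hγ' : 0 ≤ γ') (hB₈ : 0 < B₈) (hB₀8 : inp.B₀ ≤ B₈) (hB : 2 ≤ 5 * (d : ℝ) * L * B₈)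
    (hγB : 5 * (d : ℝ) * L * inp.B₀ + 2 * (γ' * inp.B₀) ≤ 5 * (d : ℝ) * L * B₈)
    {J : Type} (ι : J → ZdIdx d L) (p : J → ℕ)
    (Adm : J → Φ → (Site d → Fin d → 𝔸ˣ) → ℝ → ℝ → Prop)
    (LanF : J → (Site d → Fin d → 𝔸ˣ) → Φ → ℕ → (Site d → Fin d → 𝔸ˣ) → Prop)
    (SP5base : ∀ a : J, ∀ α₀ α₁ : ℝ, 0 < α₀ → 0 < α₁ → α₀ + α₁ ≤ cP →
      ∀ U₀ U' : Site d → Fin d → 𝔸ˣ, (∀ x κ, U₀ x κ ∈ unitaryUnits 𝔸) → (∀ x κ, U' x κ ∈ unitaryUnits 𝔸) →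
      IsPeriodic (p a) U₀ → IsPeriodic (p a) U' → ∀ φ : Φ, Adm a φ U₀ α₀ α₁ →
      InAk L (ι a).k (ι a).η α₀ (ι a).Ω U₀ → InAk L (ι a).k (ι a).η α₀ (ι a).Ω (mulCfg U' U₀) → (∀ m, m ≤ (ι a).k → InAx L m ((ι a).Λs m) U₀ (mulCfg U' U₀)) →
      (∀ j, j ≤ (ι a).k → ∀ (z : Site d) (μ : Fin d),
        ((∀ x, InBox (tlo L z j) (thi L z j) x → x ∈ (ι a).Ω j) ∨ (∀ x, InBox (tlo L (z + e μ) j) (thi L (z + e μ) j) x → x ∈ (ι a).Ω j)) →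
        ‖(avgIter L (mulCfg U' U₀) j z μ : 𝔸) - (avgIter L U₀ j z μ : 𝔸)‖ ≤ α₁) →
      (∀ b ∈ {b : Site d × Fin d | SideTouches ((ι a).Ω 0) b.1 b.2}, ‖((U' b.1 b.2 : 𝔸ˣ) : 𝔸) - 1‖ ≤ α₁) →
      (∃ (v : Site d → 𝔸ˣ) (lam : Site d → 𝔸), (∀ x, v x ∈ unitaryUnits 𝔸) ∧ (∀ x, x ∉ (ι a).Ω 0 → v x = 1) ∧
        (∀ j, j ≤ 1 → ∀ b ∈ {b : Site d × Fin d | SideTouches ((ι a).Ω j) b.1 b.2}, (v b.1 : 𝔸) = ((gaugeExp lam b.1 : 𝔸ˣ) : 𝔸) ∧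
        (v (b.1 + e b.2) : 𝔸) = ((gaugeExp lam (b.1 + e b.2) : 𝔸ˣ) : 𝔸)) ∧
        (∀ j, j ≤ 1 → ∀ b ∈ {b : Site d × Fin d | SideTouches ((ι a).Ω j) b.1 b.2},
        ‖lam b.1‖ ≤ (8 * inp.B₀' * (5 * (d : ℝ) * L * B₈) * (α₀ + α₁)) ∧ ((L : ℝ) ^ j * (ι a).η) * ‖covDerivFwd (ι a).η U₀ b.2 lam b.1‖ ≤ (8 * inp.B₀' * (5 * (d : ℝ) * L * B₈) * (α₀ + α₁))) ∧
        LanF a U₀ φ 1 (mgauge U₀ v⁻¹ U') ∧ Restr129 L 1 ((ι a).Λs 1) U₀ ((1 : Site d → 𝔸ˣ) * v) ∧ IsPeriodic (p a) v))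
    (SP5 : ∀ a : J, ∀ α₀ α₁ : ℝ, 0 < α₀ → 0 < α₁ → α₀ + α₁ ≤ cP →
      ∀ U₀ U' : Site d → Fin d → 𝔸ˣ, (∀ x κ, U₀ x κ ∈ unitaryUnits 𝔸) → (∀ x κ, U' x κ ∈ unitaryUnits 𝔸) →
      IsPeriodic (p a) U₀ → IsPeriodic (p a) U' → ∀ φ : Φ, Adm a φ U₀ α₀ α₁ →
      InAk L (ι a).k (ι a).η α₀ (ι a).Ω U₀ → InAk L (ι a).k (ι a).η α₀ (ι a).Ω (mulCfg U' U₀) → (∀ m, m ≤ (ι a).k → InAx L m ((ι a).Λs m) U₀ (mulCfg U' U₀)) →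
      (∀ j, j ≤ (ι a).k → ∀ (z : Site d) (μ : Fin d),
        ((∀ x, InBox (tlo L z j) (thi L z j) x → x ∈ (ι a).Ω j) ∨ (∀ x, InBox (tlo L (z + e μ) j) (thi L (z + e μ) j) x → x ∈ (ι a).Ω j)) →
        ‖(avgIter L (mulCfg U' U₀) j z μ : 𝔸) - (avgIter L U₀ j z μ : 𝔸)‖ ≤ α₁) →
      (∀ b ∈ {b : Site d × Fin d | SideTouches ((ι a).Ω 0) b.1 b.2}, ‖((U' b.1 b.2 : 𝔸ˣ) : 𝔸) - 1‖ ≤ α₁) →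
      (∀ m, 1 ≤ m → m < (ι a).k → ∀ (u₁ : Site d → 𝔸ˣ) (U₁ : Site d → Fin d → 𝔸ˣ) (A : Site d → Fin d → 𝔸),
        (∀ x, u₁ x ∈ unitaryUnits 𝔸) → (∀ x, x ∉ (ι a).Ω 0 → u₁ x = 1) → IsPeriodic (p a) u₁ → IsPeriodic (p a) U₁ → IsPeriodic (p a) A →
        mgauge U₀ u₁ U₁ = U' → Restr129 L m ((ι a).Λs m) U₀ u₁ → LanF a U₀ φ m U₁ →
        (∀ j, j ≤ m → ∀ b ∈ {b : Site d × Fin d | SideTouches ((ι a).Ω j) b.1 b.2},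
        U₁ b.1 b.2 = cfgExp (ι a).η A b.1 b.2 ∧ IsSelfAdjoint (A b.1 b.2) ∧ ‖A b.1 b.2‖ ≤ (5 * (d : ℝ) * L * B₈ * (α₀ + α₁)) * ((L : ℝ) ^ j * (ι a).η)⁻¹) →
        ∃ (v : Site d → 𝔸ˣ) (lam : Site d → 𝔸), (∀ x, v x ∈ unitaryUnits 𝔸) ∧ (∀ x, x ∉ (ι a).Ω 0 → v x = 1) ∧
        (∀ j, j ≤ m + 1 → ∀ b ∈ {b : Site d × Fin d | SideTouches ((ι a).Ω j) b.1 b.2}, (v b.1 : 𝔸) = ((gaugeExp lam b.1 : 𝔸ˣ) : 𝔸) ∧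
        (v (b.1 + e b.2) : 𝔸) = ((gaugeExp lam (b.1 + e b.2) : 𝔸ˣ) : 𝔸)) ∧
        (∀ j, j ≤ m + 1 → ∀ b ∈ {b : Site d × Fin d | SideTouches ((ι a).Ω j) b.1 b.2},
        ‖lam b.1‖ ≤ (8 * inp.B₀' * (5 * (d : ℝ) * L * B₈) * (α₀ + α₁)) ∧ ((L : ℝ) ^ j * (ι a).η) * ‖covDerivFwd (ι a).η U₀ b.2 lam b.1‖ ≤ (8 * inp.B₀' * (5 * (d : ℝ) * L * B₈) * (α₀ + α₁))) ∧
        LanF a U₀ φ (m + 1) (mgauge U₀ v⁻¹ U₁) ∧ Restr129 L (m + 1) ((ι a).Λs (m + 1)) U₀ (u₁ * v) ∧ IsPeriodic (p a) v))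
    (SH59src : ∀ a : J, ∀ α₀ α₁ : ℝ, 0 < α₀ → 0 < α₁ → α₀ + α₁ ≤ cP →
      ∀ U₀ U' : Site d → Fin d → 𝔸ˣ, (∀ x κ, U₀ x κ ∈ unitaryUnits 𝔸) → (∀ x κ, U' x κ ∈ unitaryUnits 𝔸) →
      IsPeriodic (p a) U₀ → IsPeriodic (p a) U' → ∀ φ : Φ, Adm a φ U₀ α₀ α₁ →
      InAk L (ι a).k (ι a).η α₀ (ι a).Ω U₀ → InAk L (ι a).k (ι a).η α₀ (ι a).Ω (mulCfg U' U₀) → (∀ m, m ≤ (ι a).k → InAx L m ((ι a).Λs m) U₀ (mulCfg U' U₀)) →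
      (∀ j, j ≤ (ι a).k → ∀ (z : Site d) (μ : Fin d),
        ((∀ x, InBox (tlo L z j) (thi L z j) x → x ∈ (ι a).Ω j) ∨ (∀ x, InBox (tlo L (z + e μ) j) (thi L (z + e μ) j) x → x ∈ (ι a).Ω j)) →
        ‖(avgIter L (mulCfg U' U₀) j z μ : 𝔸) - (avgIter L U₀ j z μ : 𝔸)‖ ≤ α₁) →
      (∀ b ∈ {b : Site d × Fin d | SideTouches ((ι a).Ω 0) b.1 b.2}, ‖((U' b.1 b.2 : 𝔸ˣ) : 𝔸) - 1‖ ≤ α₁) →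
      (∀ m, 1 ≤ m → m ≤ (ι a).k → ∀ (u : Site d → 𝔸ˣ) (W : Site d → Fin d → 𝔸ˣ) (A' : Site d → Fin d → 𝔸),
        (∀ x, u x ∈ unitaryUnits 𝔸) → IsPeriodic (p a) u → IsPeriodic (p a) W → IsPeriodic (p a) A' →
        mgauge U₀ u W = U' → Restr129 L m ((ι a).Λs m) U₀ u → LanF a U₀ φ m W →
        (∀ y τ, IsSelfAdjoint (A' y τ)) →
        (∀ j, j ≤ m → ∀ y τ, SideTouches ((ι a).Ω j) y τ →
        W y τ = cfgExp (ι a).η A' y τ ∧ ‖A' y τ‖ ≤ (2 * (L * (5 * (d : ℝ) * L * B₈ * (α₀ + α₁))) + 8 * (8 * inp.B₀' * (5 * (d : ℝ) * L * B₈) * (α₀ + α₁))) * ((L : ℝ) ^ j * (ι a).η)⁻¹) →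
        (∀ y τ, (∀ j, j ≤ m → ¬ SideTouches ((ι a).Ω j) y τ) → A' y τ = 0) →
        msup L m (ι a).η (-(1 : ℝ)) (fun j (b : Site d × Fin d) => SideTouches ((ι a).Ω j) b.1 b.2) (fun b => A' b.1 b.2)
        ≤ inp.B₀ * (bondNorm L m (ι a).η (-(3 : ℝ)) (ι a).Ω (fun x μ => Jcur (ι a).η U₀ A' μ x)
        + wsup 1 (fun p : {p : ℕ × (Site d × Fin d) // p.1 ≤ m ∧ p.2 ∈ towerBondsP L (ι a).Ω ((ι a).Λs m) p.1} =>
        linCovIter L U₀ (iEta (ι a).η A') p.1.1 p.1.2.1 p.1.2.2)) + γ' * inp.B₀ * (α₀ + α₁) ∧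
        msup L m (ι a).η (-(2 : ℝ)) (fun j (t : Fin d × Fin d × Site d) => SideTouches ((ι a).Ω j) t.2.2 t.2.1)
        (fun t => covDerivFwd (ι a).η U₀ t.1 (fun z => A' z t.2.1) t.2.2)
        ≤ inp.B₀ * (bondNorm L m (ι a).η (-(3 : ℝ)) (ι a).Ω (fun x μ => Jcur (ι a).η U₀ A' μ x)
        + wsup 1 (fun p : {p : ℕ × (Site d × Fin d) // p.1 ≤ m ∧ p.2 ∈ towerBondsP L (ι a).Ω ((ι a).Λs m) p.1} =>
        linCovIter L U₀ (iEta (ι a).η A') p.1.1 p.1.2.1 p.1.2.2)) + γ' * inp.B₀ * (α₀ + α₁)))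
    (SP5u : ∀ a : J, ∀ α₀ α₁ : ℝ, 0 < α₀ → 0 < α₁ → α₀ + α₁ ≤ cP →
      ∀ U₀ U' : Site d → Fin d → 𝔸ˣ, (∀ x κ, U₀ x κ ∈ unitaryUnits 𝔸) → (∀ x κ, U' x κ ∈ unitaryUnits 𝔸) →
      IsPeriodic (p a) U₀ → IsPeriodic (p a) U' → ∀ φ : Φ, Adm a φ U₀ α₀ α₁ →
      InAk L (ι a).k (ι a).η α₀ (ι a).Ω U₀ → InAk L (ι a).k (ι a).η α₀ (ι a).Ω (mulCfg U' U₀) → (∀ m, m ≤ (ι a).k → InAx L m ((ι a).Λs m) U₀ (mulCfg U' U₀)) →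
      (∀ j, j ≤ (ι a).k → ∀ (z : Site d) (μ : Fin d),
        ((∀ x, InBox (tlo L z j) (thi L z j) x → x ∈ (ι a).Ω j) ∨ (∀ x, InBox (tlo L (z + e μ) j) (thi L (z + e μ) j) x → x ∈ (ι a).Ω j)) →
        ‖(avgIter L (mulCfg U' U₀) j z μ : 𝔸) - (avgIter L U₀ j z μ : 𝔸)‖ ≤ α₁) →
      (∀ b ∈ {b : Site d × Fin d | SideTouches ((ι a).Ω 0) b.1 b.2}, ‖((U' b.1 b.2 : 𝔸ˣ) : 𝔸) - 1‖ ≤ α₁) →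
      ∀ u₁ : Site d → 𝔸ˣ, (∀ x, u₁ x ∈ unitaryUnits 𝔸) → (∀ x, x ∉ (ι a).Ω 0 → u₁ x = 1) → IsPeriodic (p a) u₁ → Restr129 L (ι a).k ((ι a).Λs (ι a).k) U₀ u₁ →
      LanF a U₀ φ (ι a).k (mgauge U₀ u₁⁻¹ U') →
      (∃ A₁ : Site d → Fin d → 𝔸, ∀ j, j ≤ (ι a).k → ∀ (x : Site d) (κ : Fin d), SideTouches ((ι a).Ω j) x κ →
        mgauge U₀ u₁⁻¹ U' x κ = cfgExp (ι a).η A₁ x κ ∧ ‖A₁ x κ‖ ≤ (5 * (d : ℝ) * L * B₈ * (α₀ + α₁)) * ((L : ℝ) ^ j * (ι a).η)⁻¹) →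
      ∀ (v w : Site d → 𝔸ˣ) (lam mu : Site d → 𝔸),
      IsPeriodic (p a) v → IsPeriodic (p a) w → IsPeriodic (p a) lam → IsPeriodic (p a) mu →
      (∀ x, ((gaugeExp lam x : 𝔸ˣ) : 𝔸) = ((v x : 𝔸ˣ) : 𝔸) ∧ IsSelfAdjoint (lam x) ∧ ‖lam x‖ < cu) → (∀ x, x ∉ (ι a).Ω 0 → lam x = 0) →
      (∀ j, j ≤ (ι a).k → ∀ b ∈ {b : Site d × Fin d | SideTouches ((ι a).Ω j) b.1 b.2}, ((L : ℝ) ^ j * (ι a).η) * ‖covDerivFwd (ι a).η U₀ b.2 lam b.1‖ < cu) →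
      (∀ x, ((gaugeExp mu x : 𝔸ˣ) : 𝔸) = ((w x : 𝔸ˣ) : 𝔸) ∧ IsSelfAdjoint (mu x) ∧ ‖mu x‖ < cu) → (∀ x, x ∉ (ι a).Ω 0 → mu x = 0) →
      (∀ j, j ≤ (ι a).k → ∀ b ∈ {b : Site d × Fin d | SideTouches ((ι a).Ω j) b.1 b.2}, ((L : ℝ) ^ j * (ι a).η) * ‖covDerivFwd (ι a).η U₀ b.2 mu b.1‖ < cu) →
      LanF a U₀ φ (ι a).k (mgauge U₀ v⁻¹ (mgauge U₀ u₁⁻¹ U')) → Restr129 L (ι a).k ((ι a).Λs (ι a).k) U₀ (u₁ * v) →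
      LanF a U₀ φ (ι a).k (mgauge U₀ w⁻¹ (mgauge U₀ u₁⁻¹ U')) → Restr129 L (ι a).k ((ι a).Λs (ι a).k) U₀ (u₁ * w) →
      ∀ x, v x = w x)
    -- the ZERO SOURCE (admitted everywhere; its level-`k` gauge condition = the carrier's (1.38) `Landau`)
    (φ₀ : Φ) (hAdm₀ : ∀ a : J, ∀ α₀ α₁ : ℝ, 0 < α₀ → 0 < α₁ → ∀ U₀ : Site d → Fin d → 𝔸ˣ, (∀ x κ, U₀ x κ ∈ unitaryUnits 𝔸) →
      Adm a φ₀ U₀ α₀ α₁)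
    (hLan₀ : ∀ a : J, ∀ U₀ W : Site d → Fin d → 𝔸ˣ,
      LanF a U₀ φ₀ (ι a).k W ↔ IsLandau138W L (ι a).k (ι a).η ((ι a).Ω 0) ((ι a).Λs (ι a).k) U₀ W)
    -- the image lies in the `Ω₀ = ℤᵈ` members; their tower laws at every truncation (`IdxB8Sub.tower_all` at NODE 00's law members)
    (hΩ : ∀ a : J, (ι a).Ω 0 = Set.univ)
    -- the domains `Ω_j`, `j ≤ k`, are `(p a)`-periodic (the periodic (1.5)-index's law; print's «Ω_j ⊂ T_η», p. 77)
    (hΩp : ∀ a : J, ∀ j, j ≤ (ι a).k → IsPeriodic (p a) (fun x : Site d => x ∈ (ι a).Ω j))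
    (htw : ∀ a : J, ∀ m, m ≤ (ι a).k → ∀ j, j ≤ m → ∀ y ∈ (ι a).Λs m j, ∀ x, InBox (tlo L y j) (thi L y j) x → x ∈ (ι a).Ω j)
    -- PROPOSITION 3 AS PRINTED on the IMAGE family (dag-n05-d's `prop3Printed_zdGF3P_map_γ (ι)`, A6: not over all `ZdIdx`), any `C₂ ≤ 2097152(d+1)²L²`
    (hP3 : B8.Prop3Printed d (L : ℝ) C₂ inp B₀β (fun a : J => (zdGF3HP₂Per 𝔸 L β len (ι a) (p a)).toGFData2)) :
    B8.Thm2Printed (fun a : J => (zdGF3HP₂Per 𝔸 L β len (ι a) (p a)).toGFData) := by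
  have hL1 : 1 ≤ L := le_trans (by norm_num) hL
  have hd1 : 1 ≤ d := le_trans (by norm_num) hd2
  have hL' : (1 : ℝ) ≤ L := by exact_mod_cast hL1
  have hd' : (1 : ℝ) ≤ d := by exact_mod_cast hd1
  have hB₀ : 0 < inp.B₀ := inp.B₀_pos
  have hB₀' : 0 < inp.B₀' := inp.B₀'_pos
  -- Theorem 4's constant `B₈ ≥ B₀`
  have hKB₀ : 0 < B₈ := hB₈
  have hBK : 2 ≤ 5 * (d : ℝ) * L * B₈ := hB
  -- the two instances, the windows
  obtain ⟨c4, hc4, H4⟩ := thm4Body_zdGF3HP₂Per_mapJ_γ' (𝔸 := 𝔸) (β := β) (len := len) hd2 hL hB₀ hB₀' hcu hcP hγ' hB₈ hB₀8 hB hγB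
    ι p Adm LanF SP5base SP5 SH59src SP5u φ₀ hAdm₀ hLan₀
  obtain ⟨c3, hc3, H3⟩ := hP3
  obtain ⟨cw, hcw, hw⟩ := thm4_windows_γ hd1 hL1 hKB₀ hB₀' hBK
  obtain ⟨cw', hcw', hw'⟩ := thm4_windows_extra (d := d) hL1
  -- constants
  set D : ℝ := 1 + 11 * (d : ℝ) ^ 2 with hD_def
  have hD1 : 1 ≤ D := le_add_of_nonneg_right (by positivity)
  have hD0 : 0 < D := lt_of_lt_of_le one_pos hD1
  have hDne : D ≠ 0 := hD0.ne'
  have hK₁ : 0 < 5 * (d : ℝ) * L * inp.B₀ := by positivity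
  have hK₂ : 0 < 5 * (d : ℝ) * L * B₀β := by positivity
  set B₁ : ℝ := 5 * (d : ℝ) * L * inp.B₀ * D with hB₁_def
  set B₂ : ℝ := 5 * (d : ℝ) * L * B₀β * D with hB₂_def
  have hB₁0 : 0 < B₁ := mul_pos hK₁ hD0
  have hB₂0 : 0 < B₂ := mul_pos hK₂ hD0
  have hK₁D : 0 < 5 * (d : ℝ) * L * B₈ * D := mul_pos (by positivity) hD0
  have hK₁Dne : 5 * (d : ℝ) * L * B₈ * D ≠ 0 := hK₁D.ne'
  -- the threshold: the shifted pair must fit every window; Prop 3's three smallness conditions; the (1.65) window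
  set cT : ℝ := min (min (c4 / D) (min (cw / D) (cw' / D)))
    (min (min (c3 / D) (c3 / (5 * (d : ℝ) * L * B₈ * D))) (1 / (6 * D))) with hcT_def
  have hcT : 0 < cT :=
    lt_min (lt_min (div_pos hc4 hD0) (lt_min (div_pos hcw hD0) (div_pos hcw' hD0)))
      (lt_min (lt_min (div_pos hc3 hD0) (div_pos hc3 hK₁D)) (by positivity))
  refine ⟨B₁, B₂, cT, hB₁0, hB₂0, hcT, ?_⟩
  intro i α₀ α₁ hα₀ hα₁ hs U₀ P hInA hReg hInAAx havg
  have hS0 : 0 < α₀ + α₁ := add_pos hα₀ hα₁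
  -- unpack the thresholds
  have hle : ∀ {c : ℝ}, cT ≤ c / D → D * (α₀ + α₁) ≤ c := by
    intro c hc
    have h1 : α₀ + α₁ ≤ c / D := hs.trans hc
    calc D * (α₀ + α₁) ≤ D * (c / D) := mul_le_mul_of_nonneg_left h1 hD0.le
      _ = c := by field_simp
  have hs4 : D * (α₀ + α₁) ≤ c4 := hle ((min_le_left _ _).trans (min_le_left _ _))
  have hsw : D * (α₀ + α₁) ≤ cw := hle ((min_le_left _ _).trans ((min_le_right _ _).trans (min_le_left _ _)))
  have hsw' : D * (α₀ + α₁) ≤ cw' := hle ((min_le_left _ _).trans ((min_le_right _ _).trans (min_le_right _ _)))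
  have hs3 : D * (α₀ + α₁) ≤ c3 := hle ((min_le_right _ _).trans ((min_le_left _ _).trans (min_le_left _ _)))
  have hs3' : 5 * (d : ℝ) * L * B₈ * D * (α₀ + α₁) ≤ c3 := by
    have h1 : α₀ + α₁ ≤ c3 / (5 * (d : ℝ) * L * B₈ * D) :=
      hs.trans ((min_le_right _ _).trans ((min_le_left _ _).trans (min_le_right _ _)))
    calc 5 * (d : ℝ) * L * B₈ * D * (α₀ + α₁) ≤ 5 * (d : ℝ) * L * B₈ * D * (c3 / (5 * (d : ℝ) * L * B₈ * D)) :=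
        mul_le_mul_of_nonneg_left h1 hK₁D.le
      _ = c3 := by field_simp
  have hs6 : D * (α₀ + α₁) ≤ 1 / 6 := by
    have h1 : α₀ + α₁ ≤ 1 / (6 * D) := hs.trans ((min_le_right _ _).trans (min_le_right _ _))
    calc D * (α₀ + α₁) ≤ D * (1 / (6 * D)) := mul_le_mul_of_nonneg_left h1 hD0.le
      _ = 1 / 6 := by field_simp
  -- the shifted pair `(α₀, α″)`
  set α'' : ℝ := 11 * (d : ℝ) ^ 2 * (α₀ + α₁) + α₁ with hα''_def
  have h11 : 0 ≤ 11 * (d : ℝ) ^ 2 * (α₀ + α₁) := by positivity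
  have h11' : 0 ≤ 11 * (d : ℝ) ^ 2 * α₁ := by positivity
  have hα'' : 0 < α'' := by rw [hα''_def]; linarith only [h11, hα₁]
  have hsum : α₀ + α'' = D * (α₀ + α₁) := by simp only [hα''_def, hD_def]; ring
  have hα₁'' : α₁ ≤ α'' := by rw [hα''_def]; linarith only [h11]
  have h165 : 11 * (d : ℝ) ^ 2 * α₀ + α₁ ≤ α'' := by rw [hα''_def]; linarith only [h11']
  -- windows at the shifted pair
  obtain ⟨g5, g6, g7, g9, g10, -, g14⟩ :=
    hw α₀ α'' hα₀ hα'' (hsum ▸ hsw) (5 * (d : ℝ) * L * B₈ * (α₀ + α'')) (8 * inp.B₀' * (5 * (d : ℝ) * L * B₈) * (α₀ + α'')) rfl rfl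
  obtain ⟨w19, -⟩ := hw' α₀ α'' hα₀ hα'' (hsum ▸ hsw')
  have hsmall₁ : (d : ℝ) * L * α₁ ≤ 1 / 8 := (mul_le_mul_of_nonneg_left hα₁'' (by positivity)).trans w19
  -- the un-scaled windows `C₀α₀ ≤ 1/3`, `2α₀ ≤ c₂′` for (1.65) (from the γ ones, `α₀ ≤ L²α₀`)
  have hL2 : (1 : ℝ) ≤ (L : ℝ) ^ 2 := one_le_pow₀ hL'
  have hαL2 : α₀ ≤ (L : ℝ) ^ 2 * α₀ := le_mul_of_one_le_left hα₀.le hL2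
  have w5 : C0 d * α₀ ≤ 1 / 3 := (mul_le_mul_of_nonneg_left hαL2 (C0_pos d).le).trans g5
  have hα2 : 2 * α₀ ≤ c2' d L := by linarith only [g6, hα₀, hαL2]
  -- the data
  obtain ⟨hP1, h34, hAx⟩ := hInAAx
  -- `InAAx`'s first conjunct pins the pair's background to `U₀` (as periodic carriers)
  have hQU : P.1 = U₀ := Subtype.ext (congrArg Subtype.val hP1 :)
  subst hQU
  -- the box-form letter from the member's one-end-point letter (both end-blocks inside ⇒ the first is)
  have havgBox : ∀ j, j ≤ (ι i).k → ∀ (z : Site d) (μ : Fin d), (∀ x, InBox (loK L j z) (bondHiK L j z μ) x → x ∈ (ι i).Ω j) →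
      ‖(avgIter L (mulCfg P.2.1 P.1.1) j z μ : 𝔸) - (avgIter L P.1.1 j z μ : 𝔸)‖ ≤ α₁ :=
    fun j hj z μ hg => havg j hj z μ (Or.inl fun x hx => hg x (B8Ineq165AllLevels.inBox_bondBox_of_inBox_block_fst L j z μ hx))
  -- (1.66)₀ on all bonds (Ω₀ = ℤᵈ): (1.65)
  have hpart' : ∀ x : Site d, ∃ j, j ≤ (ι i).k ∧ ∃ y ∈ (ι i).Λs (ι i).k j, InBox (tlo L y j) (thi L y j) x := by
    intro x
    have hx : x ∈ (ι i).Ω 0 := by rw [hΩ i]; trivial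
    exact (ι i).hpart x hx
  have hsm : 11 * (d : ℝ) ^ 2 * α₀ + α₁ ≤ 1 / 6 := by linarith only [h165, hα₀, hsum, hs6]
  have h66 : ∀ b ∈ {b : Site d × Fin d | SideTouches ((ι i).Ω 0) b.1 b.2}, ‖((P.2.1 b.1 b.2 : 𝔸ˣ) : 𝔸) - 1‖ ≤ α'' := by
    intro b _
    have h := norm_pert_sub_one_le_univ hd1 hL (ι i).k (η := (ι i).η) P.1.2.1 P.2.2.1 hα₀ w5 hα2 hα₁.le hsm
      (ι i).Ω (ι i).hΩ ((ι i).Λs (ι i).k) (ι i).htower hpart' hInA h34 (hAx (ι i).k le_rfl) havgBox b.1 b.2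
    exact h.trans h165
  have h166 : (zdGF3HP₂Per 𝔸 L β len (ι i) (p i)).avgClose166 α'' P.1 P :=
    ⟨fun j hj z μ hb => (havg j hj z μ hb).trans hα₁'', h66⟩
  -- THEOREM 4 at the shifted pair
  obtain ⟨u, hR, ⟨h137'', hLan, h162⟩, huniq⟩ :=
    H4 i (htw i) (hΩp i) () α₀ α'' hα₀ hα'' (hsum ▸ hs4) P.1 P hInA hReg ⟨rfl, h34, hAx⟩ h166
  -- (1.37) at the ORIGINAL α₁: the (1.42) lemma on the canonical exponent of the gauge-fixed field
  have hcs0 : 0 ≤ 5 * (d : ℝ) * L * B₈ * (α₀ + α'') := by positivity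
  have hKS0 : 0 ≤ 2 * (L * (5 * (d : ℝ) * L * B₈ * (α₀ + α''))) + 8 * (8 * inp.B₀' * (5 * (d : ℝ) * L * B₈) * (α₀ + α'')) := by
    positivity
  have hcK : 5 * (d : ℝ) * L * B₈ * (α₀ + α'') ≤
      2 * (L * (5 * (d : ℝ) * L * B₈ * (α₀ + α''))) + 8 * (8 * inp.B₀' * (5 * (d : ℝ) * L * B₈) * (α₀ + α'')) := by
    have h₁ : (1 : ℝ) * (5 * (d : ℝ) * L * B₈ * (α₀ + α'')) ≤ L * (5 * (d : ℝ) * L * B₈ * (α₀ + α'')) :=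
      mul_le_mul_of_nonneg_right hL' hcs0
    have h₂ : 0 ≤ 8 * (8 * inp.B₀' * (5 * (d : ℝ) * L * B₈) * (α₀ + α'')) := by positivity
    linarith only [h₁, h₂, hcs0]
  have h16KS : 16 * (2 * (L * (5 * (d : ℝ) * L * B₈ * (α₀ + α''))) + 8 * (8 * inp.B₀' * (5 * (d : ℝ) * L * B₈) * (α₀ + α''))) ≤ 1 := by
    have h₁ := mul_le_mul_of_nonneg_right hL' hKS0
    linarith only [g7, h₁]
  have hc16 : 16 * (5 * (d : ℝ) * L * B₈ * (α₀ + α'')) ≤ 1 := by linarith only [h16KS, hcK, hKS0]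
  have hu : ∀ x, u.1 x ∈ unitaryUnits 𝔸 := u.2.1.1
  have hW : mgauge P.1.1 u.1 (mgauge P.1.1 u.1⁻¹ P.2.1) = P.2.1 := mgauge_mgauge_inv P.1.1 P.2.1 u.1
  have hWu : ∀ x κ, mgauge P.1.1 u.1⁻¹ P.2.1 x κ ∈ unitaryUnits 𝔸 := mem_unitaryUnits_of_mgauge_eq P.1.2.1 P.2.2.1 hu hW
  have hWA : ∀ j, j ≤ (ι i).k → ∀ y τ, SideTouches ((ι i).Ω j) y τ →
      mgauge P.1.1 u.1⁻¹ P.2.1 y τ = cfgExp (ι i).η (logCfg (ι i).η (mgauge P.1.1 u.1⁻¹ P.2.1)) y τ ∧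
        ‖logCfg (ι i).η (mgauge P.1.1 u.1⁻¹ P.2.1) y τ‖ ≤ (5 * (d : ℝ) * L * B₈ * (α₀ + α'')) * ((L : ℝ) ^ j * (ι i).η)⁻¹ :=
    fun j hj y τ h => ⟨(h162 j hj (y, τ) h).1, (h162 j hj (y, τ) h).2.2⟩
  obtain ⟨hA'sa, hA'eq, hA'zero⟩ := mlogCfg_spec (ι i).hη hL1 (ι i).k P.1.1 hWu hcs0 hc16 (ι i).Ω hWA
  set A' := mlogCfg (ι i).k (ι i).η (ι i).Ω (mgauge P.1.1 u.1⁻¹ P.2.1) with hA'_def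
  have hA'bd : ∀ j, j ≤ (ι i).k → ∀ y τ, SideTouches ((ι i).Ω j) y τ →
      mgauge P.1.1 u.1⁻¹ P.2.1 y τ = cfgExp (ι i).η A' y τ ∧
        ‖A' y τ‖ ≤ (2 * (L * (5 * (d : ℝ) * L * B₈ * (α₀ + α''))) + 8 * (8 * inp.B₀' * (5 * (d : ℝ) * L * B₈) * (α₀ + α''))) *
          ((L : ℝ) ^ j * (ι i).η)⁻¹ := by
    intro j hj y τ h
    obtain ⟨hAA, hWexp⟩ := hA'eq j hj y τ h
    refine ⟨hWexp, ?_⟩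
    rw [hAA]
    have hη0 : 0 ≤ (ι i).η := (ι i).hη.le
    exact ((hWA j hj y τ h).2).trans (mul_le_mul_of_nonneg_right hcK (by positivity))
  obtain ⟨hboxP, hclassP⟩ := B8TowerBondsPrinted.ZdIdx.towerBondsP_laws (ι i)
  have h137 : (zdGF3HP₂Per 𝔸 L β len (ι i) (p i)).C137 α₁ P.1 ((zdGF3HP₂Per 𝔸 L β len (ι i) (p i)).act P u) :=
    B8Eq142KLevelLocalGammaPrime.H42_of_inAx_γ' hd2 (ι i).hη hL (ι i).k P.1.2.1 hα₀ hα₁ hKS0 g5 g6 g7 g9 g10 hsmall₁ (ι i).Ω (ι i).hΩ (ι i).Λs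
      (fun m j => towerBondsP L (ι i).Ω ((ι i).Λs m) j) hboxP hclassP hInA h34 hAx (fun j hj z μ hg => havg j hj z μ hg)
      (fun m W => IsLandau138W L m (ι i).η ((ι i).Ω 0) ((ι i).Λs m) P.1.1 W) (ι i).k (ι i).hk le_rfl (ι i).htower u.1
      (mgauge P.1.1 u.1⁻¹ P.2.1) A' hu hW hR hLan hA'sa hA'bd hA'zero
  -- PROPOSITION 3 at (α₀, α″, α₂ := c⋆″) for the gauge-fixed field
  have hSD : α₀ + α₁ ≤ D * (α₀ + α₁) := le_mul_of_one_le_left hS0.le hD1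
  have hα₀3 : α₀ ≤ c3 := by linarith only [hα₁, hSD, hs3]
  have hα''3 : α'' ≤ c3 := by linarith only [hα₀, hsum, hs3]
  have hcs3 : 5 * (d : ℝ) * L * B₈ * (α₀ + α'') ≤ c3 := by
    rw [hsum, ← mul_assoc]; exact hs3'
  have hcspos : 0 < 5 * (d : ℝ) * L * B₈ * (α₀ + α'') := by positivity
  have h61 : 2 * (5 * (d : ℝ) * L * B₈ * (α₀ + α'')) ^ 2 + 20 * d * α₀ * (5 * (d : ℝ) * L * B₈ * (α₀ + α'')) +
      2 * C₂ * (5 * (d : ℝ) * L * B₈ * (α₀ + α'')) ^ 2 ≤ α₀ + α'' := by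
    set c := 5 * (d : ℝ) * L * B₈ * (α₀ + α'') with hc
    set K := 2 * (L * c) + 8 * (8 * inp.B₀' * (5 * (d : ℝ) * L * B₈) * (α₀ + α'')) with hK
    have hcKle : c ≤ K := hcK
    have hc0 : 0 ≤ c := hcs0
    have hC : (16 : ℝ) * (131072 * ((d : ℝ) + 1) ^ 2) * (L : ℝ) ^ 2 = 2097152 * ((d : ℝ) + 1) ^ 2 * (L : ℝ) ^ 2 := by ring
    have hC₂' : C₂ ≤ 16 * (131072 * ((d : ℝ) + 1) ^ 2) * (L : ℝ) ^ 2 := by rw [hC]; exact hC₂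
    have hmono : 2 * c ^ 2 + 20 * d * α₀ * c + 2 * C₂ * c ^ 2 ≤
        2 * K ^ 2 + 20 * d * α₀ * K + 2 * (16 * (131072 * ((d : ℝ) + 1) ^ 2) * (L : ℝ) ^ 2) * K ^ 2 := by
      have h1 : c ^ 2 ≤ K ^ 2 := pow_le_pow_left₀ hc0 hcKle 2
      have h2 : 0 ≤ 20 * (d : ℝ) * α₀ := by positivity
      have h3 : 0 ≤ 2 * (16 * (131072 * ((d : ℝ) + 1) ^ 2) * (L : ℝ) ^ 2) := by positivity
      have h4 := mul_le_mul_of_nonneg_left hcKle h2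
      have h5 := mul_le_mul_of_nonneg_left h1 h3
      have h6 : 2 * C₂ * c ^ 2 ≤ 2 * (16 * (131072 * ((d : ℝ) + 1) ^ 2) * (L : ℝ) ^ 2) * c ^ 2 :=
        mul_le_mul_of_nonneg_right (by linarith only [hC₂']) (sq_nonneg _)
      linarith only [h1, h4, h5, h6]
    exact hmono.trans g14
  have hPair : (zdGF3HP₂Per 𝔸 L β len (ι i) (p i)).InAPair α₀ P.1 ((zdGF3HP₂Per 𝔸 L β len (ι i) (p i)).act P u) := by
    show InAk L (ι i).k (ι i).η α₀ (ι i).Ω (mulCfg (mgauge P.1.1 u.1⁻¹ P.2.1) P.1.1)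
    have hui : ∀ x, u.1⁻¹ x ∈ U1 𝔸 := fun x => unitaryUnits_le_U1 ((unitaryUnits 𝔸).inv_mem (hu x))
    rw [mulCfg_eq_gaugeAct_of_mgauge_eq hW]
    exact (B8Ineq132.inAk_gaugeAct_iff L (ι i).k (ι i).η α₀ (ι i).Ω hui _).2 h34
  have h162' : (zdGF3HP₂Per 𝔸 L β len (ι i) (p i)).C162 1 (5 * (d : ℝ) * L * B₈ * (α₀ + α'')) P.1 ((zdGF3HP₂Per 𝔸 L β len (ι i) (p i)).act P u) := by
    intro j hj b hb
    obtain ⟨h1, h2, h3⟩ := h162 j hj b hb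
    exact ⟨h1, h2, by rw [one_mul]; exact h3⟩
  obtain ⟨h136, h139⟩ := H3 i α₀ α'' (5 * (d : ℝ) * L * B₈ * (α₀ + α'')) hα₀ hα₀3 hα'' hα''3 hcspos hcs3 h61 P.1
    ((zdGF3HP₂Per 𝔸 L β len (ι i) (p i)).act P u) hInA hReg hPair h162' hLan h137''
  -- constants: `5dLB₀(α₀ + α″) = B₁(α₀ + α₁)`, `5dL·B₀β·(α₀ + α″) = B₂(α₀ + α₁)`
  have e1 : 5 * (d : ℝ) * (L : ℝ) * inp.B₀ * (α₀ + α'') = B₁ * (α₀ + α₁) := by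
    rw [hsum, hB₁_def]; ring
  have e2 : 5 * (d : ℝ) * (L : ℝ) * B₀β * (α₀ + α'') = B₂ * (α₀ + α₁) := by rw [hsum, hB₂_def]; ring
  obtain ⟨h136a, h136g, h136h⟩ := h136
  obtain ⟨h139j, h139l⟩ := h139
  refine ⟨u, hR, ⟨⟨fun j hj b hb => ?_, by rw [← e1]; exact h136g, by rw [← e2]; exact h136h⟩, h137, hLan,
    ⟨by rw [← e1]; exact h139j, by rw [← e1]; exact h139l⟩⟩, ?_⟩
  · obtain ⟨h1, h2, h3⟩ := h136a j hj b hb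
    exact ⟨h1, h2, by rw [← e1]; exact h3⟩
  -- uniqueness: Theorem 4's, since (1.36) at `B₁(α₀ + α₁) = B₁′(α₀ + α″)` is (1.62) there and (1.37) is monotone in α₁
  · intro u' hR' h136' h137' hLan' _
    refine huniq u' hR' ?_ hLan' ?_
    · intro j hj c hc
      have hmono : 2 * (d : ℝ) * L * α₁ ≤ 2 * d * L * α'' := mul_le_mul_of_nonneg_left hα₁'' (by positivity)
      exact (h137' j hj c hc).trans_le hmono
    · intro j hj b hb
      obtain ⟨h1, h2, h3⟩ := h136'.1 j hj b hb
      refine ⟨h1, h2, ?_⟩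
      have e1' : B₁ * (α₀ + α₁) = 5 * (d : ℝ) * L * inp.B₀ * (α₀ + α'') := by rw [hsum, hB₁_def]; ring
      have hle : 5 * (d : ℝ) * L * inp.B₀ * (α₀ + α'') ≤ 5 * (d : ℝ) * L * B₈ * (α₀ + α'') := by
        have h₁ : inp.B₀ ≤ B₈ := hB₀8
        have h₂ : 0 ≤ 5 * (d : ℝ) * L := by positivity
        have h₃ : 0 ≤ α₀ + α'' := by positivity
        exact mul_le_mul_of_nonneg_right (mul_le_mul_of_nonneg_left h₁ h₂) h₃
      have hw0 : 0 ≤ ((L : ℝ) ^ j * (ι i).η)⁻¹ := inv_nonneg.2 (mul_nonneg (pow_nonneg (Nat.cast_nonneg _) _) (ι i).hη.le)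
      exact h3.trans (mul_le_mul_of_nonneg_right (e1'.le.trans hle) hw0)

end Thm2

#print axioms thm2Printed_zdGF3HP₂Per_mapJ_γ'

end Literature.MathematicalPhysics.QuantumFieldTheory.Balaban1983to89.B8Thm2ZdGF3HP2PerMapGammaPrime

end
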